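import Summits.AtomisticToContinuum.FouriersLaw.Theses.PhononMeanFreePath
import Summits.AtomisticToContinuum.FouriersLaw.Theorems.BoundaryKubo.Negative.LoadBearing
import Summits.AtomisticToContinuum.FouriersLaw.Theorems.PhononMeanFreePathBoundaryKuboUniformHarrisAux1
import Summits.AtomisticToContinuum.FouriersLaw.Theorems.PhononMeanFreePathBoundaryKuboUniformHarrisAux2
import Literature.MathematicalPhysics.KineticTheory.LangevinSemigroupProofs

/-!
# Locally uniform Harris bounds for the pinned chain near an equilibrium temperature
(stub `stub_uniformHarris_of_minorization` of line `gibbs-ttcf`, crux stmt-AtomisticToContinuum-11812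
`PhononMeanFreePath.BoundaryKubo`)

For `P = pinnedChain ω₂ lam β γ` (all `> 0`), `N + 1` sites and `T > 0`, GIVEN a minorisation of the constructed
kernels `K^δ_t = P.transitionKernel (N+1) (T+δ/2) (T-δ/2) t` on compact sets whose mass is uniform in
`|δ| ≤ δ₀` (the hypothesis; CEHR 2018 Prop. 3.6, uniform version), we prove CEHR Theorem 2.13 (2.5) with
constants `(θ, C, c)` UNIFORM in `|δ| ≤ δ₀`: each `K^δ` has a weak steady state `ν_δ` integrating `e^{θH}` with
`|K^δ_t f(z) - ν_δ(f)| ≤ C e^{θH(z)} e^{-ct}` for continuous `|f| ≤ e^{θH}`.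

Proof = the tree's proof of `pinnedChainSemigroup_ergodic` (Props. 3.7–3.8 of CEHR) re-threaded with the bath
temperatures confined to `[T - δ₀/2, T + δ₀/2] ⊂ (0, Tm]`, `Tm = T + δ₀/2`, `θ = 1/(2Tm)`:
H2 at `t* = 1` with `κ = ½`, `c`, `K = {H ≤ E₁}` uniform (`uniformHarris_uniformH2`, helper 1); the drift
`P_m V ≤ 2^{-m} V + B` for the skeleton and the compact sublevel set `{V ≤ R}`; the hypothesis supplies `t_C`,
`m = max(1, ⌈t_C⌉)` and a mass `α` uniform in `δ`; Harris' theorem with one pair `(ᾱ, β)` for the whole family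
(`harris_uniform`, helper 2); the invariant probability measure of `pinnedChainSemigroup_ergodic` at
`(T+δ/2, T-δ/2)` is a weak steady state (`pinnedChain_isSteadyState_of_isInvariant`), its `V`-moment is
`≤ B/(1-2^{-m})`; and the continuous-time step with (3.4), `e^{θγ(T_L+T_R)t} = e^{2θγT t}`
(`semigroup_exp_convergence_explicit`, helper 2).
-/

noncomputable section

open scoped NNReal ENNReal Topology
open MeasureTheory Filter Set

namespace Summit.AtomisticToContinuum.FouriersLaw.Theorems.BoundaryKubo.GibbsTtcf

open Literature.MathematicalPhysics.KineticTheory.HeatConduction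
open Literature.MathematicalPhysics.KineticTheory Literature.Probability.Process OscillatorChain
open ProbabilityTheory
open Summit.AtomisticToContinuum.FouriersLaw.Theorems.BoundaryKubo.Negative.LoadBearing
  (kuboIntegrand kuboValue LimitClause UniqueSteady SteadyFamily boundaryKubo_iff)

set_option maxHeartbeats 1600000 in
/-- **Locally uniform Harris bounds from a locally uniform minorisation** (CEHR 2018 Thm 2.13 (2.5) for the
constructed kernels at bath temperatures `(T+δ/2, T-δ/2)`, constants uniform in `|δ| ≤ δ₀`): if every compact
set is small for `K^δ_t` at all large `t` with a mass `α` independent of `|δ| ≤ δ₀` (`δ₀ < 2T`), then there are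
`θ ∈ (0, 1/T)`, `C, c > 0` such that for every `|δ| ≤ δ₀` the kernels `K^δ` have a weak steady state `ν_δ`
integrating `e^{θH}` with `|K^δ_t f(z) - ν_δ(f)| ≤ C e^{θH(z)} e^{-ct}` for all `z`, `t` and continuous
`|f| ≤ e^{θH}` (uniform H2, Harris with explicit constants, Krylov–Bogoliubov per `δ`, (3.4)).
[cite: CuneoEckmannHairerReyBellet2018, Thm 2.13 (3) and Prop 3.8] -/
theorem stub_uniformHarris_of_minorization :
    (∀ ω₂ lam β γ : ℝ, 0 < ω₂ → 0 < lam → 0 < β → 0 < γ → ∀ (N : ℕ) (T : ℝ), 0 < T →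
      ∃ δ₀ : ℝ, 0 < δ₀ ∧ δ₀ < 2 * T ∧
        ∀ C : Set (PhaseSpace (N + 1)), IsCompact C → ∃ t_C : ℝ≥0, ∀ t : ℝ≥0, t_C ≤ t →
          ∃ α : ℝ≥0∞, 0 < α ∧ ∀ δ : ℝ, |δ| ≤ δ₀ →
            ∃ ν : Measure (PhaseSpace (N + 1)), IsProbabilityMeasure ν ∧
              ∀ z ∈ C, α • ν ≤
                (pinnedChain ω₂ lam β γ).transitionKernel (N + 1) (T + δ / 2) (T - δ / 2) t z) →
    (∀ ω₂ lam β γ : ℝ, 0 < ω₂ → 0 < lam → 0 < β → 0 < γ → ∀ (N : ℕ) (T : ℝ), 0 < T →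
      ∃ δ₀ θ C c : ℝ, 0 < δ₀ ∧ δ₀ < 2 * T ∧ 0 < θ ∧ θ * T < 1 ∧ 0 < C ∧ 0 < c ∧
        ∀ δ : ℝ, |δ| ≤ δ₀ →
          ∃ ν : Measure (PhaseSpace (N + 1)),
            (pinnedChain ω₂ lam β γ).IsSteadyState (N + 1) (T + δ / 2) (T - δ / 2) ν ∧
            Integrable (fun z => Real.exp (θ * (pinnedChain ω₂ lam β γ).hamiltonian (N + 1) z)) ν ∧
            ∀ (z : PhaseSpace (N + 1)) (t : ℝ≥0) (f : PhaseSpace (N + 1) → ℝ), Continuous f →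
              (∀ y, |f y| ≤ Real.exp (θ * (pinnedChain ω₂ lam β γ).hamiltonian (N + 1) y)) →
              |(∫ y, f y ∂((pinnedChain ω₂ lam β γ).transitionKernel (N + 1)
                    (T + δ / 2) (T - δ / 2) t z)) - ∫ y, f y ∂ν| ≤
                C * Real.exp (θ * (pinnedChain ω₂ lam β γ).hamiltonian (N + 1) z) * Real.exp (-c * t)) := by
  intro hUM ω₂ lam β γ hω hl hβ hγ N T hT
  obtain ⟨δ₀, hδ₀0, hδ₀T, hmin⟩ := hUM ω₂ lam β γ hω hl hβ hγ N T hT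
  -- the temperature window `[T - δ₀/2, T + δ₀/2] ⊂ (0, Tm]` and the exponent `θ = 1/(2 Tm)`
  set Tm : ℝ := T + δ₀ / 2 with hTmdef
  have hTm0 : 0 < Tm := by rw [hTmdef]; positivity
  set θ : ℝ := 1 / (2 * Tm) with hθdef
  have hθ0 : 0 < θ := by rw [hθdef]; positivity
  have hθTm : θ < 1 / Tm := by
    rw [hθdef]; exact one_div_lt_one_div_of_lt hTm0 (by linarith)
  have hθT : θ * T < 1 := by
    rw [hθdef, one_div, inv_mul_lt_iff₀ (by positivity)]; linarith
  -- notation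
  set Pc := pinnedChain ω₂ lam β γ with hPc
  set Hm := Pc.hamiltonian (N + 1) with hHm
  have hN1 : 0 < N + 1 := Nat.succ_pos N
  have hHc : Continuous Hm := pinnedChain_continuous_hamiltonian ω₂ lam β γ (N + 1)
  have hH0 : ∀ z, 0 ≤ Hm z := pinnedChain_hamiltonian_nonneg hω.le hl.le hβ.le γ (N + 1)
  set V : PhaseSpace (N + 1) → ℝ≥0 := fun z => (Real.exp (θ * Hm z)).toNNReal with hVdef
  have hVc : Continuous V := continuous_real_toNNReal.comp (Real.continuous_exp.comp
    (continuous_const.mul hHc))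
  have hV : Measurable V := hVc.measurable
  have hVcoe : ∀ z, (V z : ℝ≥0∞) = ENNReal.ofReal (Real.exp (θ * Hm z)) := fun z => rfl
  have hVreal : ∀ z, (V z : ℝ) = Real.exp (θ * Hm z) := fun z =>
    Real.coe_toNNReal _ (Real.exp_pos _).le
  -- uniform H2 at `t* = 1`: drift constants `a = 1/2`, `b₀ = c_u`
  obtain ⟨E₁, hE₁⟩ := uniformHarris_uniformH2 ω₂ lam β γ hω hl hβ hγ (N + 1) hN1 Tm θ hTm0 hθ0 hθTm
    1 one_pos
  set cu : ℝ := Real.exp (2 * θ * γ * Tm * ((1 : ℝ≥0) : ℝ)) * Real.exp (θ * E₁) with hcu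
  have hcu0 : 0 < cu := by rw [hcu]; positivity
  set a : ℝ≥0 := (1 / 2 : ℝ).toNNReal with ha
  set b₀ : ℝ≥0 := cu.toNNReal with hb₀
  have ha1 : a < 1 := by
    rw [← NNReal.coe_lt_coe, ha, Real.coe_toNNReal _ (by norm_num), NNReal.coe_one]; norm_num
  set B : ℝ≥0 := b₀ / (1 - a) with hB
  have h1a : 0 < 1 - a := tsub_pos_of_lt ha1
  set R : ℝ≥0 := (2 * B + 1) / (1 - a) with hRdef
  have hRa : (1 - a) * R = 2 * B + 1 := by
    rw [hRdef, mul_comm, div_mul_cancel₀ _ h1a.ne']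
  -- the compact sublevel set `{V ≤ R}` and the uniform minorisation on it
  have hcptR : IsCompact {z : PhaseSpace (N + 1) | V z ≤ R} :=
    pinnedChain_isCompact_setOf_exp_le hω hl.le hβ.le γ (N + 1) hθ0 R
  obtain ⟨t_C, ht_C⟩ := hmin _ hcptR
  set m : ℕ := max 1 ⌈t_C⌉₊ with hm
  have hm1 : 1 ≤ m := le_max_left _ _
  have hm0 : m ≠ 0 := by omega
  have hmpos : 0 < m := Nat.pos_of_ne_zero hm0
  have hmt : t_C ≤ (m : ℝ≥0) := (Nat.le_ceil t_C).trans (by exact_mod_cast le_max_right _ _)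
  obtain ⟨αE, hαE0, hαE⟩ := ht_C (m : ℝ≥0) hmt
  have hαne0 : min αE 1 ≠ 0 := (lt_min hαE0 one_pos).ne'
  have hαnetop : min αE 1 ≠ ∞ := ((min_le_right _ _).trans_lt ENNReal.one_lt_top).ne
  set α : ℝ≥0 := (min αE 1).toNNReal with hαdef
  have hα0 : 0 < α := ENNReal.toNNReal_pos hαne0 hαnetop
  have hαle : (α : ℝ≥0∞) ≤ αE := by
    rw [hαdef, ENNReal.coe_toNNReal hαnetop]; exact min_le_left _ _
  -- Harris with one pair `(ᾱ, β)` for the whole family of skeleton kernels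
  have hγ1 : a ^ m < 1 := pow_lt_one₀ zero_le ha1 hm0
  have hRcond : 2 * B < (1 - a ^ m) * R := by
    have ham : a ^ m ≤ a := pow_le_of_le_one zero_le ha1.le hm0
    calc 2 * B < 2 * B + 1 := lt_add_one _
      _ = (1 - a) * R := hRa.symm
      _ ≤ (1 - a ^ m) * R := mul_le_mul_of_nonneg_right (tsub_le_tsub_left ham 1) zero_le
  obtain ⟨abar, bH, hab0, hab1, hbH, hHarris⟩ :=
    harris_uniform (X := PhaseSpace (N + 1)) hγ1 hα0 hRcond
  -- the uniform moment bound and the continuous-time constants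
  set Mb : ℝ := ((B / (1 - a ^ m) : ℝ≥0) : ℝ) with hMbdef
  have hMb0 : 0 ≤ Mb := NNReal.coe_nonneg _
  set Cs : ℝ := θ * γ * (2 * T) with hCsdef
  have hCs0 : 0 ≤ Cs := by rw [hCsdef]; positivity
  set Cfin : ℝ := (bH⁻¹ * (2 + bH * Mb) + 1) * Real.exp (Cs * m) / abar with hCfin
  set cfin : ℝ := -Real.log abar / m with hcfin
  have hCfin0 : 0 < Cfin := by rw [hCfin]; positivity
  have hlog : Real.log abar < 0 := Real.log_neg hab0 hab1
  have hcfin0 : 0 < cfin := by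
    rw [hcfin]; exact div_pos (by linarith) (by exact_mod_cast hmpos)
  refine ⟨δ₀, θ, Cfin, cfin, hδ₀0, hδ₀T, hθ0, hθT, hCfin0, hcfin0, fun δ hδ => ?_⟩
  -- a fixed `δ`: the temperatures `(T_L, T_R) = (T + δ/2, T - δ/2) ∈ (0, Tm]²`
  have hδ' := abs_le.1 hδ
  set TL : ℝ := T + δ / 2 with hTL
  set TR : ℝ := T - δ / 2 with hTR
  have hTL0 : 0 < TL := by rw [hTL]; linarith
  have hTR0 : 0 < TR := by rw [hTR]; linarith
  have hTLm : TL ≤ Tm := by rw [hTL, hTmdef]; linarith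
  have hTRm : TR ≤ Tm := by rw [hTR, hTmdef]; linarith
  have hmax0 : 0 < max TL TR := lt_max_of_lt_left hTL0
  have hθmax : θ < 1 / max TL TR :=
    hθTm.trans_le (one_div_le_one_div_of_le hmax0 (max_le hTLm hTRm))
  have hsum : TL + TR = 2 * T := by rw [hTL, hTR]; ring
  set S := pinnedChainSemigroup hω hl.le hβ.le hγ.le hN1 hTL0.le hTR0.le with hS
  -- H2 at `t* = 1`: the drift condition for `P₁`
  have hdrift1 : ∀ z, ∫⁻ y, V y ∂(S.kernel 1 z) ≤ (a : ℝ≥0∞) * V z + b₀ := by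
    intro z
    refine (hE₁ TL TR hTL0 hTLm hTR0 hTRm z).trans ?_
    have hind : cu * ({x | Hm x ≤ E₁} : Set (PhaseSpace (N + 1))).indicator 1 z ≤ cu := by
      calc cu * ({x | Hm x ≤ E₁} : Set (PhaseSpace (N + 1))).indicator 1 z ≤ cu * 1 := by
            refine mul_le_mul_of_nonneg_left ?_ hcu0.le
            exact Set.indicator_le_self' (fun _ _ => zero_le_one) z
        _ = cu := mul_one cu
    calc ENNReal.ofReal (1 / 2 * Real.exp (θ * Hm z) +
          cu * ({x | Hm x ≤ E₁} : Set (PhaseSpace (N + 1))).indicator 1 z)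
        ≤ ENNReal.ofReal (1 / 2 * Real.exp (θ * Hm z)) +
            ENNReal.ofReal (cu * ({x | Hm x ≤ E₁} : Set (PhaseSpace (N + 1))).indicator 1 z) :=
          ENNReal.ofReal_add_le
      _ ≤ ENNReal.ofReal (1 / 2 * Real.exp (θ * Hm z)) + ENNReal.ofReal cu :=
          add_le_add le_rfl (ENNReal.ofReal_le_ofReal hind)
      _ = ENNReal.ofReal (1 / 2) * ENNReal.ofReal (Real.exp (θ * Hm z)) + ENNReal.ofReal cu := by
          rw [ENNReal.ofReal_mul (by norm_num)]
      _ = (a : ℝ≥0∞) * V z + b₀ := rfl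
  -- the skeleton kernel `P_m = P₁ᵐ` and its drift condition
  set Pk : Kernel (PhaseSpace (N + 1)) (PhaseSpace (N + 1)) := S.kernel m with hPdef
  have hPpow : Pk = S.kernel 1 ^ m := by
    rw [hPdef, ← S.kernel_nat_mul 1 m, mul_one]
  haveI : IsMarkovKernel Pk := S.isMarkovKernel _
  have hdriftP : ∀ z, ∫⁻ y, V y ∂(Pk z) ≤ ((a ^ m : ℝ≥0) : ℝ≥0∞) * V z + B := by
    intro z
    rw [hPpow, ENNReal.coe_pow]
    exact Harris.lintegral_pow_le_of_drift (S.kernel 1) hV ha1 hdrift1 m z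
  -- the minorisation of `P_m` on `{V ≤ R}` with the uniform mass `α`
  obtain ⟨ν₁, hν₁, hν₁le⟩ := hαE δ hδ
  have hminor : ∀ x, V x ≤ R → α • ν₁ ≤ Pk x := by
    intro x hx
    have hsmul : ((α : ℝ≥0∞) • ν₁ : Measure (PhaseSpace (N + 1))) ≤ αE • ν₁ :=
      Measure.le_iff'.2 fun s => by
        simp only [Measure.smul_apply, smul_eq_mul]
        gcongr
    rw [ENNReal.smul_def]
    exact hsmul.trans (hν₁le x hx)
  obtain ⟨-, hmom⟩ := hHarris Pk inferInstance V hV hdriftP ν₁ hν₁ hminor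
  -- the invariant probability measure at `(T_L, T_R)` and its Harris bounds
  obtain ⟨-, μs, hμs, hinv, hint⟩ := pinnedChainSemigroup_ergodic hω hl.le hβ hγ hN1 hTL0 hTR0
  obtain ⟨hμV, hgeo⟩ := hmom μs hμs (hinv m)
  have hintθ : Integrable (fun z => Real.exp (θ * Hm z)) μs := (hint θ hθ0 hθmax).1
  refine ⟨μs, pinnedChain_isSteadyState_of_isInvariant hω.le hl.le hβ.le γ (N + 1) S hinv hθ0 hintθ,
    hintθ, fun z t f hf hfV => ?_⟩
  -- (3.4) with `T_L + T_R = 2T`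
  have h34 : ∀ (s : ℝ≥0) (x : PhaseSpace (N + 1)),
      ∫⁻ y, ENNReal.ofReal (Real.exp (θ * Hm y)) ∂(S.kernel s x) ≤
        ENNReal.ofReal (Real.exp (Cs * s) * Real.exp (θ * Hm x)) := by
    intro s x
    have h := lintegral_exp_mul_hamiltonian_pinnedChainSemigroup_le hω hl.le hβ.le hγ.le hN1 hTL0.le
      hTR0.le hTL0 hTR0 hθ0 hθmax s x
    rw [hsum] at h
    exact h
  -- the uniform moment bound
  have hμVb : (∫⁻ z, ENNReal.ofReal (Real.exp (θ * Hm z)) ∂μs).toReal ≤ Mb := by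
    have h1 : (∫⁻ z, (V z : ℝ≥0∞) ∂μs).toReal ≤ (((B / (1 - a ^ m) : ℝ≥0) : ℝ≥0∞)).toReal :=
      ENNReal.toReal_mono ENNReal.coe_ne_top hμV
    rw [ENNReal.coe_toReal] at h1
    simpa only [hVcoe] using h1
  -- the skeleton bound in the `e^{θH}` spelling
  have hgeo' : ∀ (n : ℕ) (φ : PhaseSpace (N + 1) → ℝ), Measurable φ →
      (∀ x, |φ x| ≤ 1 + bH * Real.exp (θ * Hm x)) →
      ∀ x, |∫ y, φ y ∂((S.kernel m ^ n) x) - ∫ y, φ y ∂μs| ≤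
        abar ^ n * (2 + bH * Real.exp (θ * Hm x) +
          bH * (∫⁻ y, ENNReal.ofReal (Real.exp (θ * Hm y)) ∂μs).toReal) := by
    intro n φ hφm hφ x
    have hφ' : ∀ x, |φ x| ≤ 1 + bH * V x := fun x => by rw [hVreal]; exact hφ x
    have h := hgeo n φ hφm hφ' x
    simpa only [hVreal, hVcoe] using h
  have key := semigroup_exp_convergence_explicit S hHc hH0 hθ0 hCs0 h34 hmpos hab0 hab1 hbH hMb0 μs
    hμVb hgeo' z t f hf hfV
  rw [LangevinChainSemigroup.act_apply] at key
  exact key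

end Summit.AtomisticToContinuum.FouriersLaw.Theorems.BoundaryKubo.GibbsTtcf

end
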